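import Summits.PneNP.PneNP.Theses.RamseyAliens
import Literature.Computability.Complexity.KarpCliqueNP
import Literature.Computability.Complexity.CodeFPLists
import Literature.Computability.Complexity.CodeFPStrings
import Literature.Computability.Complexity.CodeFPBudgets
import Literature.Computability.Complexity.NPClosureProofs
import Literature.Computability.Complexity.EquivalenceProblemsPHProofs
import Literature.Computability.Complexity.PRelHierarchy
import Literature.Computability.Complexity.PromiseProofs
import Literature.Computability.Complexity.NondeterministicProofs

/-!
# Route RamseyAliens — `RamseySigmaTwo` (stmt-PneNP-2278)

`L_R = {⟨1^m, 1^k⟩ : some graph on m vertices has neither a k-clique nor a k-independent set} ∈ Σ₂ᵖ`.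
`Σ₂ᵖ = ∃ᵖ·coΣ₁ᵖ = ∃ᵖ·coNP` (`SigmaP_one_holds`); the witness `y` is an adjacency bit field (`m² ≤ |w|²` bits), read as
the graph `G_y = fromRel (y[i m + j])` on `Fin m`; the `coNP` language is "`w` is a pair of unary numerals, and neither
`code(⟨m, G_y⟩, k)` nor `code(⟨m, G_yᶜ⟩, k)` lies in `CLIQUE`" — its complement is a `P` language joined with two
polynomial-time preimages of `CLIQUE ∈ NP` (`CLIQUE_mem_NP`, proved), the two instance codes being typed `CodeFP` programs
(unary → binary headers, the `m²` adjacency bits of `G_y` / `G_yᶜ` by one pass over `[0, m²)`).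
-/

set_option linter.dupNamespace false -- `Summit.PneNP.PneNP.…`: summit = sub-problem name (D-0017 single-conjunct layout)

namespace Summit.PneNP.PneNP.Theorems

open _root_.Computability Polynomial
open Literature.Computability.Complexity Literature.Computability.Complexity.CodeFP
  Literature.Computability.Complexity.Brick

open Classical in
/-- **Adjacency bits as a pass over `[0, m²)`**: if `b i j = [G.Adj i j]` on `Fin m` then
`adjBits m G = [b (t / m) (t % m) | t < m²]`. [folklore] -/
theorem ramseyAliens_adjBits_eq_map {m : ℕ} (G : SimpleGraph (Fin m)) (b : ℕ → ℕ → Bool)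
    (hb : ∀ i j : Fin m, b i j = decide (G.Adj i j)) :
    CliqueNP.adjBits m G = (List.range (m * m)).map fun t => b (t / m) (t % m) := by
  refine List.ext_getElem (by simp) fun t h1 h2 => ?_
  have ht : t < m * m := by simpa using h1
  have e := CliqueNP.getD_adjBits G ht
  rw [List.getD_eq_getElem _ _ h1] at e
  rw [e, List.getElem_map, List.getElem_range]
  exact (hb ⟨t / m, _⟩ ⟨t % m, _⟩).symm

/-- **The two instance codes are polynomial time.** On `u = ⟨⟨1^m, 1^k⟩, y⟩` (and on every string, with `m = |fst (fst u)|`,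
`k = |snd (fst u)|`, `y = snd u`): the code `⟨⟨bin m, bits⟩, bin k⟩` whose bit `t = i m + j` is
`[i ≠ j] ∧ (flag = (y[i m + j] ∨ y[j m + i]))` — the adjacency bits of `G_y` (`flag = 1`) or of `G_yᶜ` (`flag = 0`).
[cite: AroraBarakCC2009, §1.3] [folklore] -/
theorem ramseyAliens_instCode_mem_FP (flag : Bool) :
    (fun u : List Bool => boolPair (boolPair (encodeNat (fstF (fstF u)).length)
      ((List.range ((fstF (fstF u)).length * (fstF (fstF u)).length)).map fun t =>
        (!decide (t / (fstF (fstF u)).length = t % (fstF (fstF u)).length)) &&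
          (flag == ((sndF u).getD (t / (fstF (fstF u)).length * (fstF (fstF u)).length + t % (fstF (fstF u)).length) false ||
            (sndF u).getD (t % (fstF (fstF u)).length * (fstF (fstF u)).length + t / (fstF (fstF u)).length) false))))
      (encodeNat (sndF (fstF u)).length)) ∈ FP := by
  have hfst : CodeFP strE strE fun w : List Bool => fstF w := CodeFP.of_fn fstF fstF_mem_FP fun _ => rfl
  have hsnd : CodeFP strE strE fun w : List Bool => sndF w := CodeFP.of_fn sndF sndF_mem_FP fun _ => rfl
  have hlenN : CodeFP strE natE fun w : List Bool => w.length := (natOfUn.comp strLength :)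
  have hm : CodeFP strE natE fun u : List Bool => (fstF (fstF u)).length := (hlenN.comp (hfst.comp hfst) :)
  have hk : CodeFP strE natE fun u : List Bool => (sndF (fstF u)).length := (hlenN.comp (hsnd.comp hfst) :)
  have unMul : CodeFP (pairE unE unE) unE fun p : ℕ × ℕ => p.1 * p.2 :=
    ((ulength unitE).comp (unitsMul.comp ((replicateUnit.comp (CodeFP.fst _ _)).pair
      (replicateUnit.comp (CodeFP.snd _ _))))).congr fun p => by simp
  have hBB : CodeFP strE unE fun u : List Bool => u.length * u.length := (unMul.comp (strLength.pair strLength) :)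
  have hmm : CodeFP strE natE fun u : List Bool => (fstF (fstF u)).length * (fstF (fstF u)).length := (natMul.comp (hm.pair hm) :)
  have hidx : CodeFP strE (rawE natE) fun u : List Bool =>
      List.range (min ((fstF (fstF u)).length * (fstF (fstF u)).length) (u.length * u.length)) :=
    (rangeOf.comp (hBB.pair hmm) :)
  -- one bit, in context `((y, m), t)`
  have qy : CodeFP (pairE (pairE strE natE) natE) strE fun q : (List Bool × ℕ) × ℕ => q.1.1 := (CodeFP.fst _ _).fst'
  have qm : CodeFP (pairE (pairE strE natE) natE) natE fun q : (List Bool × ℕ) × ℕ => q.1.2 := (CodeFP.fst _ _).snd'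
  have qt : CodeFP (pairE (pairE strE natE) natE) natE fun q : (List Bool × ℕ) × ℕ => q.2 := CodeFP.snd _ _
  have qi : CodeFP (pairE (pairE strE natE) natE) natE fun q : (List Bool × ℕ) × ℕ => q.2 / q.1.2 := (natDiv.comp (qt.pair qm) :)
  have qj : CodeFP (pairE (pairE strE natE) natE) natE fun q : (List Bool × ℕ) × ℕ => q.2 % q.1.2 := (natMod.comp (qt.pair qm) :)
  have hne : CodeFP (pairE (pairE strE natE) natE) bitE fun q : (List Bool × ℕ) × ℕ => !decide (q.2 / q.1.2 = q.2 % q.1.2) :=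
    (natEq.comp (qi.pair qj) :).not
  have hb1 : CodeFP (pairE (pairE strE natE) natE) bitE fun q : (List Bool × ℕ) × ℕ =>
      q.1.1.getD (q.2 / q.1.2 * q.1.2 + q.2 % q.1.2) false :=
    (strGetDNat.comp (qy.pair (natAdd.comp ((natMul.comp (qi.pair qm)).pair qj))) :)
  have hb2 : CodeFP (pairE (pairE strE natE) natE) bitE fun q : (List Bool × ℕ) × ℕ =>
      q.1.1.getD (q.2 % q.1.2 * q.1.2 + q.2 / q.1.2) false :=
    (strGetDNat.comp (qy.pair (natAdd.comp ((natMul.comp (qj.pair qm)).pair qi))) :)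
  have hflag : CodeFP (pairE (pairE strE natE) natE) bitE fun q : (List Bool × ℕ) × ℕ =>
      flag == (q.1.1.getD (q.2 / q.1.2 * q.1.2 + q.2 % q.1.2) false || q.1.1.getD (q.2 % q.1.2 * q.1.2 + q.2 / q.1.2) false) :=
    ((CodeFP.beq bitE_injective).comp ((CodeFP.const _ flag).pair (hb1.or hb2)) :)
  have hbit := hne.and hflag
  have hraw := ((CodeFP.map hbit).comp ((hsnd.pair hm).pair hidx) :
    CodeFP strE (rawE bitE) fun u : List Bool => (List.range (min ((fstF (fstF u)).length * (fstF (fstF u)).length)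
      (u.length * u.length))).map fun t => _)
  have hstr := (bitsToStr.comp hraw :)
  obtain ⟨F, hF, hFspec⟩ := (hm.pair hstr).pair hk
  have hle : ∀ u : List Bool, (fstF (fstF u)).length * (fstF (fstF u)).length ≤ u.length * u.length := by
    intro u
    have h1 := length_boolUnpair_parts_le u
    have h2 := length_boolUnpair_parts_le (fstF u)
    have h3 : (fstF (fstF u)).length ≤ u.length := by
      change (boolUnpair (boolUnpair u).1).1.length ≤ _
      change 2 * (boolUnpair (boolUnpair u).1).1.length + _ ≤ (boolUnpair u).1.length at h2
      omega
    exact Nat.mul_le_mul h3 h3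
  convert hF using 1
  funext u
  have h := hFspec u
  rw [show strE u = u from rfl] at h
  rw [h]
  simp only [pairE_apply, min_eq_left (hle u)]
  rfl

/-- **`RamseySigmaTwo` (stmt-PneNP-2278)**: `L_R ∈ Σ₂ᵖ`. Witness = adjacency bits (`≤ |w|²`); the `coNP` matrix
language = "pair of unary numerals, and neither `code(⟨m, G_y⟩, k)` nor `code(⟨m, G_yᶜ⟩, k)` is in `CLIQUE`".
[cite: Stockmeyer1976, §3] [cite: Karp1972, §4 Main Theorem, problem 3] -/
theorem ramseyAliens_ramseySigmaTwo_proof : Summit.PneNP.PneNP.Theses.RamseyAliens.RamseySigmaTwo := by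
  classical
  -- the graph read off a string and the two instance codes
  set Gr : (u : List Bool) → SimpleGraph (Fin (fstF (fstF u)).length) := fun u =>
    SimpleGraph.fromRel fun i j : Fin (fstF (fstF u)).length =>
      (sndF u).getD (i * (fstF (fstF u)).length + j) false = true with hGr
  have hGrAdj : ∀ (u : List Bool) (n : ℕ) (hn : (fstF (fstF u)).length = n) (i j : Fin (fstF (fstF u)).length),
      (Gr u).Adj i j ↔ (i : ℕ) ≠ j ∧ ((sndF u).getD (i * n + j) false = true ∨ (sndF u).getD (j * n + i) false = true) := by
    intro u n hn i j
    subst hn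
    simp only [hGr, SimpleGraph.fromRel_adj, ne_eq, Fin.ext_iff]
  set f : Bool → List Bool → List Bool := fun flag u => boolPair (boolPair (encodeNat (fstF (fstF u)).length)
      ((List.range ((fstF (fstF u)).length * (fstF (fstF u)).length)).map fun t =>
        (!decide (t / (fstF (fstF u)).length = t % (fstF (fstF u)).length)) &&
          (flag == ((sndF u).getD (t / (fstF (fstF u)).length * (fstF (fstF u)).length + t % (fstF (fstF u)).length) false ||
            (sndF u).getD (t % (fstF (fstF u)).length * (fstF (fstF u)).length + t / (fstF (fstF u)).length) false))))
      (encodeNat (sndF (fstF u)).length) with hf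
  have hfFP : ∀ flag, f flag ∈ FP := fun flag => ramseyAliens_instCode_mem_FP flag
  -- the codes are genuine CLIQUE instance codes of `G_y` and `G_yᶜ`
  have hcode : ∀ u : List Bool, f true u = CliqueNP.instEnc.encode (⟨(fstF (fstF u)).length, Gr u⟩, (sndF (fstF u)).length) ∧
      f false u = CliqueNP.instEnc.encode (⟨(fstF (fstF u)).length, (Gr u)ᶜ⟩, (sndF (fstF u)).length) := by
    intro u
    have hA := hGrAdj u _ rfl
    constructor
    · rw [CliqueNP.instEnc_encode_eq, ramseyAliens_adjBits_eq_map (Gr u)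
        (fun i j => (!decide (i = j)) && (true == ((sndF u).getD (i * (fstF (fstF u)).length + j) false ||
          (sndF u).getD (j * (fstF (fstF u)).length + i) false)))]
      intro i j
      have hA' := hA i j
      generalize (sndF u).getD (↑i * (fstF (fstF u)).length + ↑j) false = A at hA' ⊢
      generalize (sndF u).getD (↑j * (fstF (fstF u)).length + ↑i) false = B at hA' ⊢
      rw [Bool.eq_iff_iff, @decide_eq_true_iff _ (_), hA']
      cases A <;> cases B <;> simp
    · rw [CliqueNP.instEnc_encode_eq, ramseyAliens_adjBits_eq_map (Gr u)ᶜ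
        (fun i j => (!decide (i = j)) && (false == ((sndF u).getD (i * (fstF (fstF u)).length + j) false ||
          (sndF u).getD (j * (fstF (fstF u)).length + i) false)))]
      intro i j
      have hA' := hA i j
      generalize (sndF u).getD (↑i * (fstF (fstF u)).length + ↑j) false = A at hA' ⊢
      generalize (sndF u).getD (↑j * (fstF (fstF u)).length + ↑i) false = B at hA' ⊢
      rw [Bool.eq_iff_iff, @decide_eq_true_iff _ (_), SimpleGraph.compl_adj, hA']
      cases A <;> cases B <;> simp [Fin.ext_iff]
  have hmemC : ∀ u : List Bool, (f true u ∈ CLIQUE ↔ ¬ (Gr u).CliqueFree (sndF (fstF u)).length) ∧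
      (f false u ∈ CLIQUE ↔ ¬ (Gr u)ᶜ.CliqueFree (sndF (fstF u)).length) := by
    intro u
    have key : ∀ p, CliqueNP.instEnc.encode p ∈ CLIQUE ↔ p ∈ cliqueSet := fun p => by
      rw [CliqueNP.CLIQUE_eq_image]
      exact ⟨fun ⟨q, hq, hqp⟩ => CliqueNP.instEnc.encode_injective hqp ▸ hq, fun hp => ⟨p, hp, rfl⟩⟩
    rw [(hcode u).1, (hcode u).2, key, key]
    exact ⟨Iff.rfl, Iff.rfl⟩
  -- the `P` test: `fst u` is a pair of unary numerals
  have hones : CodeFP strE strE fun w : List Bool => List.replicate w.length true :=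
    CodeFP.of_fn onesFn onesFn_mem_FP fun w => (unE_eq_ones w.length).trans rfl
  have hfst : CodeFP strE strE fun w : List Bool => fstF w := CodeFP.of_fn fstF fstF_mem_FP fun _ => rfl
  have hsnd : CodeFP strE strE fun w : List Bool => sndF w := CodeFP.of_fn sndF sndF_mem_FP fun _ => rfl
  have hwp : CodeFP strE bitE fun w : List Bool => decide (boolPair (fstF w) (sndF w) = w) :=
    CodeFP.of_fn CliqueNP.wpF CliqueNP.wpF_mem_FP fun w => by rw [CliqueNP.wpF_apply]; rfl
  have hall : CodeFP strE bitE fun w : List Bool => decide (w = List.replicate w.length true) :=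
    ((CodeFP.eq (α := List Bool) (eα := strE) Function.injective_id).comp ((CodeFP.id strE).pair hones) :)
  obtain ⟨g, hg, hgspec⟩ := (hwp.comp hfst :).and (((hall.comp (hfst.comp hfst) :).and (hall.comp (hsnd.comp hfst) :)))
  set W : Language Bool := g ⁻¹' PRelSigma.HeadIs true with hW
  have hWP : W ∈ Classes.P := preimage_mem_P (PRelSigma.HeadIs_mem_P true) hg
  have hWsem : ∀ u : List Bool, u ∈ W ↔ boolPair (fstF (fstF u)) (sndF (fstF u)) = fstF u ∧
      fstF (fstF u) = List.replicate (fstF (fstF u)).length true ∧ sndF (fstF u) = List.replicate (sndF (fstF u)).length true := by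
    intro u
    change g (strE u) ∈ PRelSigma.HeadIs true ↔ _
    rw [hgspec, PRelSigma.mem_HeadIs]
    simp [bitE]
  -- the coNP matrix language
  set V : Language Bool := W ⊓ ((f true ⁻¹' CLIQUE) ⊔ (f false ⁻¹' CLIQUE))ᶜ with hV
  have hVco : V ∈ co Nondeterministic.NP := by
    change Vᶜ ∈ Nondeterministic.NP
    rw [hV, compl_inf, compl_compl]
    exact CFKer.union_mem_NP (P_subset_NP_holds (compl_mem_P_iff.2 hWP))
      (CFKer.union_mem_NP (preimage_mem_NP CLIQUE_mem_NP (hfFP true)) (preimage_mem_NP CLIQUE_mem_NP (hfFP false)))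
  -- Σ₂ᵖ = ∃ᵖ·coNP
  have hS1 : SigmaP 1 = Nondeterministic.NP := SigmaP_one_holds
  show _ ∈ SigmaP 2
  rw [SigmaP_succ, PiP_eq_co, hS1]
  refine ⟨V, hVco, X ^ 2, fun w => ?_⟩
  have hunary : ∀ n : ℕ, unaryEncodeNat n = List.replicate n true := fun n => (unE_eq_ones n).trans rfl
  constructor
  · rintro ⟨m, k, rfl, G, hG, hGc⟩
    refine ⟨CliqueNP.adjBits m G, ?_, ?_⟩
    · have h1 : (unaryEncodeNat m).length = m := by rw [hunary, List.length_replicate]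
      have h2 : (unaryEncodeNat k).length = k := by rw [hunary, List.length_replicate]
      rw [eval_pow, eval_X, CliqueNP.length_adjBits, length_boolPair, h1, h2]
      nlinarith
    · set u := boolPair (boolPair (unaryEncodeNat m) (unaryEncodeNat k)) (CliqueNP.adjBits m G) with hu
      have hfu : fstF (fstF u) = unaryEncodeNat m := by rw [hu, fstF_boolPair, fstF_boolPair]
      have hsu : sndF (fstF u) = unaryEncodeNat k := by rw [hu, fstF_boolPair, sndF_boolPair]
      have hyu : sndF u = CliqueNP.adjBits m G := by rw [hu, sndF_boolPair]
      have hm : (fstF (fstF u)).length = m := by rw [hfu, hunary, List.length_replicate]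
      have hk : (sndF (fstF u)).length = k := by rw [hsu, hunary, List.length_replicate]
      refine ⟨(hWsem u).2 ⟨by rw [hu, fstF_boolPair, fstF_boolPair, sndF_boolPair], ?_, ?_⟩, ?_⟩
      · rw [hm, hfu]; exact hunary m
      · rw [hk, hsu]; exact hunary k
      · -- neither code is in CLIQUE: `G_y ≅ G`
        have hadj : ∀ i j : Fin (fstF (fstF u)).length, (Gr u).Adj i j ↔ G.Adj (Fin.cast hm i) (Fin.cast hm j) := by
          intro i j
          rw [hGrAdj u m hm, hyu]
          have e1 := CliqueNP.getD_adjBits_flat G (Fin.cast hm i) (Fin.cast hm j)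
          have e2 := CliqueNP.getD_adjBits_flat G (Fin.cast hm j) (Fin.cast hm i)
          simp only [Fin.val_cast] at e1 e2
          rw [e1, e2, decide_eq_true_eq, decide_eq_true_eq]
          constructor
          · rintro ⟨-, h | h⟩
            · exact h
            · exact h.symm
          · intro h
            exact ⟨fun hij => (G.irrefl (v := Fin.cast hm j))
              (by rwa [show Fin.cast hm i = Fin.cast hm j from Fin.ext hij] at h), Or.inl h⟩
        have φ : Gr u ↪g G := ⟨⟨Fin.cast hm, Fin.cast_injective hm⟩, fun {a b} => (hadj a b).symm⟩
        have φc : (Gr u)ᶜ ↪g Gᶜ := ⟨⟨Fin.cast hm, Fin.cast_injective hm⟩, fun {a b} => by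
          simp only [Function.Embedding.coeFn_mk, SimpleGraph.compl_adj, hadj, (Fin.cast_injective hm).ne_iff]⟩
        change ¬ (f true u ∈ CLIQUE ∨ f false u ∈ CLIQUE)
        rw [(hmemC u).1, (hmemC u).2, hk, not_or, not_not, not_not]
        exact ⟨hG.comap ⟨φ.toCopy⟩, hGc.comap ⟨φc.toCopy⟩⟩
  · rintro ⟨y, -, hWy, hCy⟩
    obtain ⟨hwp', hf', hs'⟩ := (hWsem _).1 hWy
    change ¬ (f true (boolPair w y) ∈ CLIQUE ∨ f false (boolPair w y) ∈ CLIQUE) at hCy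
    rw [(hmemC _).1, (hmemC _).2, not_or, not_not, not_not] at hCy
    refine ⟨(fstF (fstF (boolPair w y))).length, (sndF (fstF (boolPair w y))).length, ?_, Gr (boolPair w y), hCy.1, hCy.2⟩
    rw [hunary, hunary, ← hf', ← hs', hwp', fstF_boolPair]

end Summit.PneNP.PneNP.Theorems
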